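import Summits.BirchSwinnertonDyer.Rank1Residual.X10.ResidualSelmerParityGroupForm
import HarnessLib

/-!
# The N2 generator test (G) in GROUP CURRENCY (cell `b2b-bsdres`, unit `b2b-bsdres-x10` = N2 class lead,
# GEN 31; TOOL — theorems only, no definition, no named fact, nothing booked; file 6 of the toolkit,
# unpacking the (G) half of `ResidualSelmerParityGroupForm.even_and_generatorTest_groupForm`)

HONEST FRAMING (run/shared/lean/b2b/bsd-rank1-residual/, verbatim in every file): the goal of the
cell is to DELETE the COMBINATION-SHAPED residual classes of the Birch–Swinnerton-Dyer formula for
ALL analytic-rank `≤ 1` elliptic curves over `ℚ` — "full BSD formula for every rank `≤ 1` curve in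
class `C`" assembled STRICTLY from published theorems — so that the rank-`≤ 1` remainder becomes
exactly the CONSTRUCTION-SHAPED classes, which are TYPED (missing-input `Prop`s), NOT attempted.
This is not "finishing BSD". Class X10b (= N2) keeps its label CONSTRUCTION-SHAPED (NEEDS `X_A3`,
referee R82.3 / RESIDUAL-MAP §I N2); this file is a TOOL; no mark / label / tier / count moves.

## What

Mazur–Rubin 2007 Prop. 1.3 (i) + Thm. 1.4 at ONE exceptional place (file 3,
`X10/ResidualSelmerGeneratorTest.lean`), in the group currency of file 5 (data `H`, `L v`, `loc`, `Λ`,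
`X`, bi-additive `b v : L v →+ L v →+ ZMod p`; inputs `hsymm`, `hnd`, `hΛ`, `hX`, `hrec`, `hPT`, `hfin`;
`Sel` and `S⁰` by membership — see that file's docstring for the dictionary with the tree's
Galois-cohomology objects and the Poitou–Tate fact): with `#Sel = p`, one exceptional place
`v₀ ∈ S \ P` (`X v = Λ v` on `S \ (P ∪ {v₀})`, local term one `#X_{v₀} = p · #(X_{v₀} ∩ Λ_{v₀})`) and a
non-zero `c ∈ Sel`:
* `eq_bot_of_generator_not_mem_groupForm` — `loc_{v₀} c ∉ Λ_{v₀}` ⟹ `S⁰ = ⊥`;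
* `natCard_eq_sq_of_generator_mem_groupForm` — `loc_{v₀} c ∈ Λ_{v₀}` ⟹ `#S⁰ = p²`;
* `exists_not_mem_of_eq_bot_groupForm` — the weak form for several exceptional places (no pairing).
THE INSTANCE (TRIVIAL-ROADS memo (G), §3): `E′ = 118810j1`, `#Sel₃(E′) = 3` EXACT (x10b), `T_{E′} = {5}`,
`c = κ(P)` for Cremona's generator `P = (187/9, 3262/27)`, which reduces to the node mod `5`, so
`κ(P)₅ ∉ H¹_ur` ⟹ `S⁰(E′[3]) = 0`, hence `S⁰(118810q1) = 0` along the twin congruence — the one N2 cell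
decided positively beyond Cremona's table.

## References

* [MazurRubin2007] B. Mazur, K. Rubin, *Finding large Selmer rank via an arithmetic theory of local
  constants*, Ann. of Math. 166 (2007), Def. 1.2, Prop. 1.3, Thm. 1.4 — arXiv:math/0512085 pp. 5–6, read.
* [KlagsbrunMazurRubin2013] Z. Klagsbrun, B. Mazur, K. Rubin, Ann. of Math. 178 (2013), §3 — read.
* HOME/class-closure/N2/{TRIVIAL-ROADS-x10g27.md, P-INSTANCE-SPEC-x10g30.md}; HOME/X10-AUDIT.md §§33–37.
-/

set_option autoImplicit false

noncomputable section

open Summit.BirchSwinnertonDyer.Rank1Residual.X10.ResidualSelmerParityGroupForm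

namespace Summit.BirchSwinnertonDyer.Rank1Residual.X10.ResidualSelmerGeneratorTestGroupForm

universe v w x

section GeneratorTest

variable {p : ℕ} [hp : Fact p.Prime] {ι : Type v} [DecidableEq ι] {H : Type w} [AddCommGroup H]
  {L : ι → Type x} [∀ v, AddCommGroup (L v)] [∀ v, Finite (L v)]

/-- **(G), ramified generator, in group currency: `S⁰ = ⊥`** (Mazur–Rubin 2007 Prop. 1.3 (i) + Thm.
1.4 at one exceptional place, file 3). Data and Poitou–Tate inputs as in (P); ONE exceptional place
`v₀ ∈ S \ P` (`X v = Λ v` on `S \ (P ∪ {v₀})`, `#X_{v₀} = p · #(X_{v₀} ∩ Λ_{v₀})`); `#Sel = p` and a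
non-zero `c ∈ Sel` with `loc_{v₀} c ∉ Λ_{v₀}`. THEN `S⁰ = ⊥`. THE INSTANCE: `E′ = 118810j1`,
`#Sel₃(E′) = 3` EXACT, `T_{E′} = {5}`, `c = κ(P)` for Cremona's generator `P = (187/9, 3262/27)`,
which reduces to the node mod `5` (`κ(P)₅ ∉ H¹_ur`) ⟹ `S⁰(E′[3]) = 0`, and `S⁰(118810q1) = 0` along
the twin congruence (memo §3). [cite: MazurRubin2007, Prop. 1.3 (i) and Thm. 1.4] -/
theorem eq_bot_of_generator_not_mem_groupForm (hp2 : p ≠ 2) (hH : ∀ c : H, p • c = 0)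
    (hL : ∀ v, ∀ x : L v, p • x = 0) (loc : ∀ v, H →+ L v) (Λ : ∀ v, AddSubgroup (L v))
    (b : ∀ v, L v →+ L v →+ ZMod p) {S₀ P S : Finset ι} {v₀ : ι} (X : ∀ v, AddSubgroup (L v))
    (hsymm : ∀ v x y, b v x y = b v y x) (hnd : ∀ v x, (∀ y, b v x y = 0) → x = 0)
    (hΛ : ∀ v, v ∉ S₀ → ∀ x, x ∈ Λ v ↔ ∀ y ∈ Λ v, b v x y = 0)
    (hX : ∀ v ∈ S, ∀ x, x ∈ X v ↔ ∀ y ∈ X v, b v x y = 0)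
    (hrec : ∀ S' : Finset ι, S₀ ⊆ S' → ∀ c d : H, (∀ v, v ∉ S' → loc v c ∈ Λ v) →
      (∀ v, v ∉ S' → loc v d ∈ Λ v) → ∑ v ∈ S', b v (loc v c) (loc v d) = 0)
    (hPT : ∀ y : ∀ v, L v, (∀ c : H, (∀ v, v ∉ S → loc v c ∈ Λ v) →
      ∑ v ∈ S, b v (loc v c) (y v) = 0) → ∃ c : H, (∀ v, v ∉ S → loc v c ∈ Λ v) ∧ ∀ v ∈ S, loc v c = y v)
    (hfin : Finite {c : H // ∀ v, v ∉ S → loc v c ∈ Λ v})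
    (hS₀P : S₀ ⊆ P) (hPS : P ⊆ S) (hv₀ : v₀ ∈ S \ P) (hoff : ∀ v ∈ S \ P, v ≠ v₀ → X v = Λ v)
    (hv₀d : Nat.card (X v₀) = p * Nat.card ↥(X v₀ ⊓ Λ v₀))
    (Sel S0 : AddSubgroup H)
    (hSel : ∀ c, c ∈ Sel ↔ (∀ v ∈ S, loc v c ∈ X v) ∧ ∀ v, v ∉ S → loc v c ∈ Λ v)
    (hS0 : ∀ c, c ∈ S0 ↔ (∀ v ∈ P, loc v c ∈ X v) ∧ ∀ v, v ∉ P → loc v c ∈ Λ v)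
    (hcard : Nat.card Sel = p) {c : H} (hc : c ∈ Sel) (hc0 : c ≠ 0) (hcv : loc v₀ c ∉ Λ v₀) :
    S0 = ⊥ :=
  ((even_and_generatorTest_groupForm hp2 hH hL loc Λ b X hsymm hnd hΛ hX hrec hPT hfin hS₀P hPS Sel S0 hSel hS0).2 v₀ c hv₀ hoff
    hv₀d hcard hc hc0).1 hcv

/-- **(G), unramified generator, in group currency: `#S⁰ = p²`.** Same data; `loc_{v₀} c ∈ Λ_{v₀}` ⟹
`#S⁰ = p²`. THE INSTANCE: a rank-one good-at-`3` `E′` with `#Sel₃ = 3`, `T_{E′} = {ℓ}` and generator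
`3`-divisible in `E′(ℚ_ℓ)` has `#S⁰(E′[3]) = 9` (memo §9). [cite: MazurRubin2007, Prop. 1.3 (i) and Thm. 1.4] -/
theorem natCard_eq_sq_of_generator_mem_groupForm (hp2 : p ≠ 2) (hH : ∀ c : H, p • c = 0)
    (hL : ∀ v, ∀ x : L v, p • x = 0) (loc : ∀ v, H →+ L v) (Λ : ∀ v, AddSubgroup (L v))
    (b : ∀ v, L v →+ L v →+ ZMod p) {S₀ P S : Finset ι} {v₀ : ι} (X : ∀ v, AddSubgroup (L v))
    (hsymm : ∀ v x y, b v x y = b v y x) (hnd : ∀ v x, (∀ y, b v x y = 0) → x = 0)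
    (hΛ : ∀ v, v ∉ S₀ → ∀ x, x ∈ Λ v ↔ ∀ y ∈ Λ v, b v x y = 0)
    (hX : ∀ v ∈ S, ∀ x, x ∈ X v ↔ ∀ y ∈ X v, b v x y = 0)
    (hrec : ∀ S' : Finset ι, S₀ ⊆ S' → ∀ c d : H, (∀ v, v ∉ S' → loc v c ∈ Λ v) →
      (∀ v, v ∉ S' → loc v d ∈ Λ v) → ∑ v ∈ S', b v (loc v c) (loc v d) = 0)
    (hPT : ∀ y : ∀ v, L v, (∀ c : H, (∀ v, v ∉ S → loc v c ∈ Λ v) →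
      ∑ v ∈ S, b v (loc v c) (y v) = 0) → ∃ c : H, (∀ v, v ∉ S → loc v c ∈ Λ v) ∧ ∀ v ∈ S, loc v c = y v)
    (hfin : Finite {c : H // ∀ v, v ∉ S → loc v c ∈ Λ v})
    (hS₀P : S₀ ⊆ P) (hPS : P ⊆ S) (hv₀ : v₀ ∈ S \ P) (hoff : ∀ v ∈ S \ P, v ≠ v₀ → X v = Λ v)
    (hv₀d : Nat.card (X v₀) = p * Nat.card ↥(X v₀ ⊓ Λ v₀))
    (Sel S0 : AddSubgroup H)
    (hSel : ∀ c, c ∈ Sel ↔ (∀ v ∈ S, loc v c ∈ X v) ∧ ∀ v, v ∉ S → loc v c ∈ Λ v)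
    (hS0 : ∀ c, c ∈ S0 ↔ (∀ v ∈ P, loc v c ∈ X v) ∧ ∀ v, v ∉ P → loc v c ∈ Λ v)
    (hcard : Nat.card Sel = p) {c : H} (hc : c ∈ Sel) (hc0 : c ≠ 0) (hcv : loc v₀ c ∈ Λ v₀) :
    Nat.card S0 = p ^ 2 :=
  ((even_and_generatorTest_groupForm hp2 hH hL loc Λ b X hsymm hnd hΛ hX hrec hPT hfin hS₀P hPS Sel S0 hSel hS0).2 v₀ c hv₀ hoff
    hv₀d hcard hc hc0).2 hcv

omit [∀ v, Finite (L v)] in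
/-- **(G), weak form, in group currency** (no pairing needed): if `X v = Λ v` on `S \ (P ∪ T)`, then
`S⁰ = ⊥` forces every non-zero `c ∈ Sel` to have `loc_v c ∉ Λ_v` at some `v ∈ T`. THE INSTANCE
(memo (G), `#T_{E′} ≥ 2`): `S⁰ = 0 ⟹ κ(P)` ramified at ≥ 1 prime of `T_{E′}`. [cite: MazurRubin2007, Def. 1.2] -/
theorem exists_not_mem_of_eq_bot_groupForm (loc : ∀ v, H →+ L v) (Λ : ∀ v, AddSubgroup (L v))
    {P S T : Finset ι} (X : ∀ v, AddSubgroup (L v)) (hoff : ∀ v ∈ S \ P, v ∉ T → X v = Λ v)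
    (Sel S0 : AddSubgroup H)
    (hSel : ∀ c, c ∈ Sel ↔ (∀ v ∈ S, loc v c ∈ X v) ∧ ∀ v, v ∉ S → loc v c ∈ Λ v)
    (hS0 : ∀ c, c ∈ S0 ↔ (∀ v ∈ P, loc v c ∈ X v) ∧ ∀ v, v ∉ P → loc v c ∈ Λ v)
    (hPS : P ⊆ S) (hbot : S0 = ⊥) {c : H} (hc : c ∈ Sel) (hc0 : c ≠ 0) : ∃ v ∈ T, loc v c ∉ Λ v := by
  by_contra h
  push Not at h
  have hc' := (hSel c).mp hc
  have hmem : c ∈ S0 := (hS0 c).mpr ⟨fun v hv => hc'.1 v (hPS hv), fun v hvP => by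
    by_cases hvT : v ∈ T
    · exact h v hvT
    · by_cases hvS : v ∈ S
      · rw [← hoff v (Finset.mem_sdiff.mpr ⟨hvS, hvP⟩) hvT]; exact hc'.1 v hvS
      · exact hc'.2 v hvS⟩
  rw [hbot, AddSubgroup.mem_bot] at hmem
  exact hc0 hmem

end GeneratorTest

end Summit.BirchSwinnertonDyer.Rank1Residual.X10.ResidualSelmerGeneratorTestGroupForm

end
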